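import Summits.AtomisticToContinuum.Crystallization.Theorems.FrustratedLawDichotomyStrainedPatchHomEntryLeafHTMustPassC
import Summits.AtomisticToContinuum.Crystallization.Theorems.FrustratedLawDichotomyStrainedPatchHomEntryFitHcpCentredLeaf

/-!
# KERNEL MUST-PASS (D): at the `0.8 t_b` must-pass cell the slab leaf with the DIRECTIONAL CENTRED inner fit closes the whole confined ξ-box in ONE inner leaf
# (27623 `(H) HomFloor (1/625)`, hcp half; critic row 1147; sequel of `…HomEntryLeafHTMustPassA/B/C` (hand-1 g29) and `…HomEntryFitHcpCentredLeaf` (hand-1 g30))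

decomp-a2c hand-1 g30 (crux `AperiodicFrustratedLawGap`, stmt-AtomisticToContinuum-27623).  Same cell `cA × wA` (`U⋆ + 0.8 t_b d₀`, z-mirrored; entries `2⁻¹³`,
shuffle `1.25·10⁻³`) and same certificate `pA` as the g29 must-pass; there the inner verdict `entryLeafOKHQ muRec` needed the 8-leaf sub-tree `tA` over the
rounded confined box `htWr pA cA wA` (ξ half-widths ≈ (2.05, 2.73, 0.97)·10⁻³, 120 s).  With the centred inner verdict `entryLeafOKHQD muRec` the TRIVIAL sub-tree
(one leaf = the whole confined box) suffices:

* `treeOKD_leaf_A` — KERNEL: `treeOK (entryLeafOKHQD muRec) .leaf cA (htWr pA cA wA) = true`;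
* ★★★ `entryLeafOKHT4QD_A_leaf` — `entryLeafOKHT4QD muRec pA .leaf cA wA = true`, assembled by rewriting from the tree fact `…MustPassC.htCertSide_A` (no long `decide`).

Kernel fact + assembly; 0 sorry; standard axioms (kernel-decide).  `--supports stmt-AtomisticToContinuum-27623`.
-/

namespace Summit.AtomisticToContinuum.Crystallization.Theorems.FrustratedLawDichotomyStrainedPatchHomEntryLeafHT

open Literature.Analysis.ValidatedNumerics.Numerics
open Summit.AtomisticToContinuum.Crystallization.Theorems.FrustratedLawDichotomyStrainedPatchHomCertTree (CertTree treeOK)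
open Summit.AtomisticToContinuum.Crystallization.Theorems.FrustratedLawDichotomyStrainedPatchHomEntryTable (muRec)
open Summit.AtomisticToContinuum.Crystallization.Theorems.FrustratedLawDichotomyStrainedPatchHomEntryFitHcpCentred (entryLeafOKHQD entryLeafOKHT4QD)

set_option maxRecDepth 100000 in
set_option maxHeartbeats 4000000 in
/-- ★★ KERNEL: the centred quick verdict `entryLeafOKHQD muRec` closes the WHOLE rounded confined box of the must-pass cell as a single leaf. -/
theorem treeOKD_leaf_A : treeOK (entryLeafOKHQD muRec) CertTree.leaf cA (htWr pA cA wA) = true := by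
  decide +kernel

/-- ★★★ **THE SLAB LEAF WITH THE CENTRED INNER FIT FIRES ON THE MUST-PASS CELL WITH A ONE-LEAF INNER TREE.** [assembly by rewriting] -/
theorem entryLeafOKHT4QD_A_leaf : entryLeafOKHT4QD muRec pA CertTree.leaf cA wA = true := by
  rw [entryLeafOKHT4QD, entryLeafOKHT4, htCertSide_A, treeOKD_leaf_A]
  simp

end Summit.AtomisticToContinuum.Crystallization.Theorems.FrustratedLawDichotomyStrainedPatchHomEntryLeafHT
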